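/-
Route `LevelGradedCohnUmans`, crux `SubgroupIdentityDesigns` (stmt-MatrixMultiplication-14079).
Cell B2b-5 (`b2b-lgcu-borel`, gen 6).  HONEST FRAMING: the VALUE here is a THEOREM / a DECIDABLE
VERDICT / a CERTIFICATE — NOT summit progress.  This file builds the diagonal Borel TPP family; it says nothing about the
small-`ε` regime that would bear on `ω`.
-/
import Mathlib
import Summits.MatrixMultiplication.MatrixMultiplication.Theorems.SubgroupIdentityDesigns.Negative.BorelFamilyF

/-!
# `SubgroupIdentityDesigns`: the diagonal Borel family `A₁ = D`

Inside the upper Borel subgroup of `GL₂(𝔽_p)` take `A₁ = D` (all diagonal matrices),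
`A₂ = u₁ · {diag(1, y) : y ∈ R₂} · u₁⁻¹` and `A₃ = u_c · {diag(1, y) : y ∈ R₃} · u_c⁻¹` for
subgroups `R₂, R₃ ≤ 𝔽_pˣ` and `c ∈ 𝔽_p` (`u_c diag(1, y) u_c⁻¹ = [[1, c(y-1)], [0, y]]`).  A
product `diag(x,z) · a₂ · a₃` equals `[[x, x(c(y₃-1) + (y₂-1)y₃)], [0, z y₂ y₃]]` (`diag_triple`),
so

* the subgroup TPP is the arithmetic condition `c(y₃-1) + (y₂-1)y₃ = 0 ⇒ y₂ = y₃ = 1` on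
  `R₂ × R₃` (`diagFamily_tpp`);
* the unipotent `u_{y₀}` is outside `A₁A₂A₃` iff `y₀` is not of the form `c(y₃-1) + (y₂-1)y₃`
  (`diagFamily_missing`), and then the level-one Borel identity test of `BorelLevelOne` applies;
* the volume is `(p-1)² |R₂| |R₃|`.

The package is `diagFamily`; its consequences for the crux (volume `3 · 30³` at `p = 31`, the crux
body for all `ε ≥ 10`) are drawn in `BorelLargeEps`.  [this cell: census of Borel triples]
-/

noncomputable section

open scoped BigOperators Classical
open Summit.MatrixMultiplication.MatrixMultiplication.Theorems.LieRankDesigns.Negative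

namespace Summit.MatrixMultiplication.MatrixMultiplication.Theorems.SubgroupIdentityDesigns.Negative

variable {p : ℕ} [Fact p.Prime]

/-- `y ↦ u_c · diag(1, y) · u_c⁻¹ = [[1, c(y-1)], [0, y]]`. -/
def conjTorus (p : ℕ) [Fact p.Prime] (c : ZMod p) : (ZMod p)ˣ →* GLm p 2 where
  toFun y := upperTri 1 y (c * ((y : ZMod p) - 1))
  map_one' := by simp
  map_mul' y y' := by
    rw [upperTri_mul, one_mul]
    congr 1
    push_cast
    ring

/-- `(x, z) ↦ diag(x, z)`, whose range is the diagonal torus `D`. -/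
def diagTorus (p : ℕ) [Fact p.Prime] : (ZMod p)ˣ × (ZMod p)ˣ →* GLm p 2 where
  toFun xz := upperTri xz.1 xz.2 0
  map_one' := by simp
  map_mul' x y := by
    rw [upperTri_mul, Prod.fst_mul, Prod.snd_mul, mul_zero, zero_mul, add_zero]

/-- Unfolding `conjTorus`. -/
theorem conjTorus_apply (c : ZMod p) (y : (ZMod p)ˣ) :
    conjTorus p c y = upperTri 1 y (c * ((y : ZMod p) - 1)) := rfl

/-- Unfolding `diagTorus`. -/
theorem diagTorus_apply (x z : (ZMod p)ˣ) : diagTorus p (x, z) = upperTri x z 0 := rfl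

/-- The generic triple product of the diagonal family, as one upper-triangular element. -/
theorem diag_triple (c : ZMod p) (x z y₂ y₃ : (ZMod p)ˣ) :
    diagTorus p (x, z) * conjTorus p 1 y₂ * conjTorus p c y₃ =
      upperTri x (z * y₂ * y₃)
        ((x : ZMod p) * (c * ((y₃ : ZMod p) - 1) + ((y₂ : ZMod p) - 1) * y₃)) := by
  rw [diagTorus_apply, conjTorus_apply, conjTorus_apply, upperTri_mul, upperTri_mul, mul_one,
    mul_one]
  congr 1
  ring

/-- `conjTorus c` is injective. -/
theorem conjTorus_injective (c : ZMod p) : Function.Injective (conjTorus p c) := by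
  intro y y' h
  rw [conjTorus_apply, conjTorus_apply] at h
  exact (upperTri_injective h).2.1

/-- `diagTorus` is injective. -/
theorem diagTorus_injective : Function.Injective (diagTorus p) := by
  rintro ⟨x, z⟩ ⟨x', z'⟩ h
  rw [diagTorus_apply, diagTorus_apply] at h
  obtain ⟨h1, h2, -⟩ := upperTri_injective h
  exact Prod.ext h1 h2

/-- `D` is upper triangular. -/
theorem diagTorus_lower : ∀ u ∈ (diagTorus p).range, (u : Mat p 2) 1 0 = 0 :=
  range_lower _ fun ⟨x, z⟩ => by rw [diagTorus_apply]; exact upperTri_lower _ _ _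

/-- Images of `conjTorus c` are upper triangular. -/
theorem conjTorus_map_lower (c : ZMod p) (R : Subgroup (ZMod p)ˣ) :
    ∀ u ∈ R.map (conjTorus p c), (u : Mat p 2) 1 0 = 0 := by
  rintro u ⟨y, -, rfl⟩
  rw [conjTorus_apply]
  exact upperTri_lower _ _ _

/-- **TPP for the diagonal family** from the arithmetic condition on `R₂ × R₃`. -/
theorem diagFamily_tpp (R₂ R₃ : Subgroup (ZMod p)ˣ) (c : ZMod p)
    (hT : ∀ y₂ ∈ R₂, ∀ y₃ ∈ R₃,
      c * ((y₃ : ZMod p) - 1) + ((y₂ : ZMod p) - 1) * y₃ = 0 → y₂ = 1 ∧ y₃ = 1) :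
    Literature.Barriers.MatrixMultiplication.SubgroupTPP
      (diagTorus p).range (R₂.map (conjTorus p 1)) (R₃.map (conjTorus p c)) := by
  rintro a ⟨⟨x, z⟩, rfl⟩ b ⟨y₂, hy₂, rfl⟩ g ⟨y₃, hy₃, rfl⟩ habc
  rw [diag_triple, ← upperTri_one] at habc
  obtain ⟨hx, hz, hY⟩ := upperTri_injective habc
  subst hx
  rw [Units.val_one, one_mul] at hY
  obtain ⟨rfl, rfl⟩ := hT y₂ hy₂ y₃ hy₃ hY
  have hz1 : z = 1 := by simpa using hz
  subst hz1
  exact ⟨by rw [Prod.mk_one_one, map_one], map_one _, map_one _⟩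

/-- **The unipotent `u_{y₀}` is missed** when `y₀` is not of the form `c(y₃-1) + (y₂-1)y₃`. -/
theorem diagFamily_missing (R₂ R₃ : Subgroup (ZMod p)ˣ) (c y₀ : ZMod p)
    (hM : ∀ y₂ ∈ R₂, ∀ y₃ ∈ R₃, c * ((y₃ : ZMod p) - 1) + ((y₂ : ZMod p) - 1) * y₃ ≠ y₀) :
    ∀ a ∈ (diagTorus p).range, ∀ b ∈ R₂.map (conjTorus p 1), ∀ g ∈ R₃.map (conjTorus p c),
      a * b * g ≠ unipUpper y₀ := by
  rintro a ⟨⟨x, z⟩, rfl⟩ b ⟨y₂, hy₂, rfl⟩ g ⟨y₃, hy₃, rfl⟩ h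
  rw [diag_triple, unipUpper_eq_upperTri] at h
  obtain ⟨hx, -, hY⟩ := upperTri_injective h
  subst hx
  rw [Units.val_one, one_mul] at hY
  exact hM y₂ hy₂ y₃ hy₃ hY

/-- The image of a subgroup under an injective homomorphism has the same cardinality. [folklore] -/
theorem natCard_map_of_injective {G N : Type*} [Group G] [Group N] (R : Subgroup G)
    (f : G →* N) (hf : Function.Injective f) : Nat.card (R.map f) = Nat.card R :=
  (Nat.card_congr (R.equivMapOfInjective f hf).toEquiv).symm

/-- **The diagonal family**: TPP triple with a rank-`≤ 1` identity test function and volume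
`(p-1)² |R₂| |R₃|`, from the two arithmetic conditions. [this cell] -/
theorem diagFamily (R₂ R₃ : Subgroup (ZMod p)ˣ) (c y₀ : ZMod p) (hy₀ : y₀ ≠ 0)
    (hT : ∀ y₂ ∈ R₂, ∀ y₃ ∈ R₃,
      c * ((y₃ : ZMod p) - 1) + ((y₂ : ZMod p) - 1) * y₃ = 0 → y₂ = 1 ∧ y₃ = 1)
    (hM : ∀ y₂ ∈ R₂, ∀ y₃ ∈ R₃, c * ((y₃ : ZMod p) - 1) + ((y₂ : ZMod p) - 1) * y₃ ≠ y₀) :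
    ∃ H₁ H₂ H₃ : Subgroup (Matrix.GeneralLinearGroup (Fin 2) (ZMod p)),
      Literature.Barriers.MatrixMultiplication.SubgroupTPP H₁ H₂ H₃ ∧
      (∃ c : Matrix (Fin 2) (Fin 2) (ZMod p) → ℂ, (∀ M, 1 < M.rank → c M = 0) ∧
        (∑ M : Matrix (Fin 2) (Fin 2) (ZMod p), c M * ZMod.stdAddChar (Matrix.trace
          (M * ((1 : Matrix.GeneralLinearGroup (Fin 2) (ZMod p)) :
            Matrix (Fin 2) (Fin 2) (ZMod p))))) = 1 ∧
        ∀ a ∈ H₁, ∀ b ∈ H₂, ∀ g ∈ H₃, a * b * g ≠ 1 →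
          (∑ M : Matrix (Fin 2) (Fin 2) (ZMod p), c M * ZMod.stdAddChar (Matrix.trace
            (M * ((a * b * g : Matrix.GeneralLinearGroup (Fin 2) (ZMod p)) :
              Matrix (Fin 2) (Fin 2) (ZMod p))))) = 0) ∧
      Nat.card H₁ * Nat.card H₂ * Nat.card H₃ = (p - 1) ^ 2 * Nat.card R₂ * Nat.card R₃ := by
  refine ⟨(diagTorus p).range, R₂.map (conjTorus p 1), R₃.map (conjTorus p c),
    diagFamily_tpp R₂ R₃ c hT,
    levelOne_idDesign_of_borel diagTorus_lower (conjTorus_map_lower 1 R₂)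
      (conjTorus_map_lower c R₃) hy₀ (diagFamily_missing R₂ R₃ c y₀ hM), ?_⟩
  rw [natCard_range_of_injective _ diagTorus_injective, natCard_map_of_injective R₂ _
      (conjTorus_injective 1), natCard_map_of_injective R₃ _ (conjTorus_injective c),
    Nat.card_prod, natCard_units]
  ring

end Summit.MatrixMultiplication.MatrixMultiplication.Theorems.SubgroupIdentityDesigns.Negative

end
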